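import Summits.QuantumFields.YangMills.Theorems.BalabanUVNodesPortS1JacDomGeom
import Summits.QuantumFields.YangMills.Theorems.BalabanUVNodesPortS1Frame
import Literature.MathematicalPhysics.QuantumFieldTheory.Balaban1983to89.B15AveragingHolomorphicTowerRegion

/-!
# NODE O port PT-A — READING A RECORD PAIR ON THE TOWER REGION OF A COARSE BOND (the `det` clause of `TowerLoopSmall` at the record, with its (i)–(iv) data): a pair of `recordUc … (X(c))` is an
# `SL(2,ℂ)` gauge transform of `embedPair Φ₀`, `Φ₀` satisfying (1.11)–(1.16) on the record frame of `X(c)`, and `det (φ^u).1 = 1` on every fine bond of the tower region `B^{k+1} ⁻¹' {c₋, c₊}`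

Cell `ym-nodeO-ideate`, porter seat `ymgap-nodeO-port-PTA-1` (gen 6); proof file, `--supports stmt-QuantumFields-27930`.  [I] = [Balaban1987RG1].  The first (bookkeeping) step of the `k`-STEP
READING `JacKStep F` (companion `…JacKStepDefs`): what membership in the record space hands to the complex small-field road — the orbit point `Φ₀ = (e^{iξA′}U, 𝐉)` with (i)–(iv) and the
`SL(2,ℂ)`-valuedness on the bonds «in `X(c)`», which contain the tower region's fine bonds.  The loop clause (small (0.4) loops of the averages `Ū^j(Φ₀.U)`, `j ≤ k`) is the genuine part and
is NOT here.
CONTENTS (theorems only).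
* §R1 `mem_domSites_domOfBond_of_blockIter` (torus form of `…JacDomGeom.cover_mem_domSites_domOfBond` via the val-lift to the universal cover), `src_tgt_mem_domSites_of_mem_bondsIn_towerRegion`
  (the fine bonds of the tower region of `c` are bonds «in `X(c)`»).
* §R2 ★ `exists_gauge_satisfies_of_mem_recordUc` (unpacking 11b's union of orbits through DEF-1's coordinates: `∃ u` with `det = 1`, `∃ Φ₀` satisfying (i)–(iv), `φ^u = embedPair Φ₀`),
  `det_eq_one_of_satisfies`, ★★ `exists_gauge_towerDet_of_mem_recordUc` (the `det` clause of `TowerLoopSmall k c a (φ^u).1` at every record pair, together with the (i)–(iv) data of `Φ₀`).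

HONEST FRAMING.  Bookkeeping over 11b's `B12RegularSpaces111` ∕ `Sect2FrameOfRecord`, DEF-1's coordinates and the porter's `domOfBond`; NOTHING of Bałaban asserted or proved; `JacKStep` ∕
`JacRowsABDom` ∕ `stub_LZjacAB` OPEN; 27930 OPEN · no claim; K0⁷∕K-Ax OPEN; NODE O 0∕1; COUNT 8∕28 · K 1∕4 UNMOVED; finite `𝕋⁴_{L^K}` at fixed ε — NOT continuum ∕ OS ∕ Clay; **the Yang–Mills
mass gap is NOT proved by any of this.**  No `sorry`, no `def`, no `instance`, no `notation`; standard axioms.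
-/

noncomputable section

open scoped BigOperators Matrix.Norms.L2Operator Topology

namespace Summit.QuantumFields.YangMills.Theorems.BalabanUVNodesPortS1

open Summit.QuantumFields.YangMills.Theorems.K0RecordFormatNames
open Literature.MathematicalPhysics.QuantumFieldTheory.Balaban1983to89
open Literature.MathematicalPhysics.QuantumFieldTheory.Balaban1983to89.Node00
open Literature.MathematicalPhysics.QuantumFieldTheory.Balaban1983to89.T4Continuum (T4Family)
open Literature.MathematicalPhysics.QuantumFieldTheory.Balaban1983to89.B10Eq42TorusConstraint (bondsIn)

/-! ## §R1  The tower region of a coarse bond lies in the record domain `X(c)` (torus form of `…JacDomGeom.cover_mem_domSites_domOfBond`) -/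

section Reading

open Literature.MathematicalPhysics.QuantumFieldTheory.Balaban1983to89.B15Eq112TorusCover (cover)
open Literature.MathematicalPhysics.QuantumLattice (blockMap)

variable (F : T4Family)

/-- A fine site whose `(k+1)`-block is an endpoint of `c` lies in the site set of the record domain `X(c) = domOfBond … c` (the val-lift to the universal cover, `…JacDomGeom.cover_mem_domSites_of_blockMap`).
[cite: Balaban1987RG1, (1.7) p.261, p.257 (bookkeeping)] -/
theorem mem_domSites_domOfBond_of_blockIter {Mc k K : ℕ} (hMc : McGuard F Mc) (hK : recordK₀ F Mc k ≤ K) (c : PBond (F.P K) (k + 1)) {x : Site (F.P K) 0}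
    (hx : B14.Eq22Determines.blockIter (k + 1) x = c.src ∨ B14.Eq22Determines.blockIter (k + 1) x = c.tgt) :
    x ∈ Sect2.domSites (F.P K) Mc (k + 1) (domOfBond F Mc k K c) := by
  have hk : k + 1 ≤ (F.P K).m + (F.P K).K := by rw [F.P_K]; unfold recordK₀ at hK; omega
  set z : Fin (F.P K).d → ℤ := fun i => ((x i).val : ℤ) with hz
  have hcov : cover (F.P K) z = x := by rw [← coverAt_zero]; exact coverAt_valLift 0 x
  have hblk : coverAt (F.P K) (k + 1) (blockMap (F.L ^ (k + 1)) z) = B14.Eq22Determines.blockIter (k + 1) x := by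
    have hci := B10Eq71TorusOverlap.cubeIdx_eq_blockIter hk x
    funext i
    have hi : (x i).val / F.L ^ (k + 1) = (B14.Eq22Determines.blockIter (k + 1) x i).val := congrFun hci i
    rw [coverAt_apply]
    have e : blockMap (F.L ^ (k + 1)) z i = (((x i).val / F.L ^ (k + 1) : ℕ) : ℤ) := by
      simp only [blockMap, hz]; push_cast; rfl
    rw [e, hi, Int.cast_natCast, ZMod.natCast_zmod_val]
  rw [← hcov]
  rcases hx with h | h
  · exact cover_mem_domSites_of_blockMap hMc hK _ (hblk.trans h) (by rw [domOfBond_val hMc hK]; exact Finset.mem_insert_self _ _)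
  · exact cover_mem_domSites_of_blockMap hMc hK _ (hblk.trans h)
      (by rw [domOfBond_val hMc hK]; exact Finset.mem_insert_of_mem (Finset.mem_singleton_self _))

/-- The fine bonds of the tower region of `c` are bonds «in `X(c)`» (both endpoints in the record domain's site set). [cite: Balaban1987RG1, (1.7) p.261 (bookkeeping)] -/
theorem src_tgt_mem_domSites_of_mem_bondsIn_towerRegion {Mc k K : ℕ} (hMc : McGuard F Mc) (hK : recordK₀ F Mc k ≤ K) (c : PBond (F.P K) (k + 1)) {b : PBond (F.P K) 0}
    (hb : b ∈ bondsIn 0 (B14.Eq22Determines.blockIter (k + 1) ⁻¹' ({c.src, c.tgt} : Set (Site (F.P K) (k + 1))))) :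
    b.src ∈ Sect2.domSites (F.P K) Mc (k + 1) (domOfBond F Mc k K c) ∧ b.tgt ∈ Sect2.domSites (F.P K) Mc (k + 1) (domOfBond F Mc k K c) := by
  obtain ⟨h1, h2⟩ := B10Eq42TorusConstraint.mem_bondsIn_iff.1 hb
  rw [B10Eq38TorusDomains.toFine_zero] at h1 h2
  exact ⟨mem_domSites_domOfBond_of_blockIter F hMc hK c ((B15AveragingHolomorphicTowerRegion.mem_preimage_blockIter_pair_iff c _).1 h1),
    mem_domSites_domOfBond_of_blockIter F hMc hK c ((B15AveragingHolomorphicTowerRegion.mem_preimage_blockIter_pair_iff c _).1 h2)⟩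

/-! ## §R2  Reading a record pair: an `SL(2,ℂ)` gauge transform of a configuration satisfying (i)–(iv) -/

/-- **UNPACKING `recordUc`** (11b's union of orbits read through DEF-1's coordinates): a pair `φ` whose coordinates lie in `recordUc F Mc k α₀ α₁ K X` has a `det = 1` gauge transformation `u` with
`φ^u = embedPair Φ₀` for a units-valued pair `Φ₀` satisfying (i)–(iv) of (1.11)–(1.16) on the record frame of `X` with radii `(α₀, α₁, γ₀ := α₀)`.
[cite: Balaban1987RG1, (1.10)–(1.16) p.262 («a union of orbits»)] -/
theorem exists_gauge_satisfies_of_mem_recordUc {Mc k K : ℕ} (X : (recordDomSys F Mc k K).Dom) {α₀ α₁ : ℝ} {φ : Sect2.CPair (F.P K) (MatA 2)}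
    (hφ : encodeCfg F K φ ∈ recordUc F Mc k α₀ α₁ K X) :
    ∃ (u : Site (F.P K) 0 → (MatA 2)ˣ) (Φ₀ : FieldPair (F.P K) 0 (MatA 2)ˣ (MatA 2)), (∀ x, ((u x : (MatA 2)ˣ) : MatA 2).det = 1) ∧
      B12RegularSpaces111.Satisfies (B12RegularSpaces111SpecialUnitary.suModel 2)
        (Sect2.frameI (RzOfRecord F 2 K) Mc (k + 1) (Sect2.domSites (F.P K) Mc (k + 1) X))
        (B12RegularSpaces111.StepConsts.ofParams (F.P K) (recordCB F) (k + 1)) α₀ α₁ α₀ Φ₀ ∧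
      Sect2.cAct u φ = Sect2.embedPair Φ₀ := by
  rw [encodeCfg_mem_recordUc_iff] at hφ
  obtain ⟨Ψ, hΨ, rfl⟩ := hφ
  obtain ⟨u', Φ₀, hu', hS, rfl⟩ := hΨ
  refine ⟨u'⁻¹, Φ₀, fun x => ?_, hS, ?_⟩
  · have hdet : ((u' x : (MatA 2)ˣ) : MatA 2).det = 1 := B12RegularSpaces111SpecialUnitary.mem_suModel_Gc.1 (hu' x)
    have h := congrArg Matrix.det (u' x).inv_mul
    rw [Matrix.det_mul, hdet, mul_one, Matrix.det_one] at h
    rw [Pi.inv_apply]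
    exact h
  · rw [Sect2.cAct_embedPair, B12RegularSpaces111.act_inv_act]

/-- On the bonds «in `X`» a configuration satisfying (i)–(iv) is `SL(2,ℂ)`-valued: `det Φ₀.U(b) = 1` («𝐔 … has values in Gᶜ», `Gᶜ = SL(2,ℂ)` of the `SU(2)` model).
[cite: Balaban1987RG1, (1.10)–(1.11) p.262] -/
theorem det_eq_one_of_satisfies {Mc k K : ℕ} (X : (recordDomSys F Mc k K).Dom) {α₀ α₁ γ₀ : ℝ} {Φ₀ : FieldPair (F.P K) 0 (MatA 2)ˣ (MatA 2)}
    (hS : B12RegularSpaces111.Satisfies (B12RegularSpaces111SpecialUnitary.suModel 2)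
      (Sect2.frameI (RzOfRecord F 2 K) Mc (k + 1) (Sect2.domSites (F.P K) Mc (k + 1) X))
      (B12RegularSpaces111.StepConsts.ofParams (F.P K) (recordCB F) (k + 1)) α₀ α₁ γ₀ Φ₀)
    {b : PBond (F.P K) 0} (h1 : b.src ∈ Sect2.domSites (F.P K) Mc (k + 1) X) (h2 : b.tgt ∈ Sect2.domSites (F.P K) Mc (k + 1) X) :
    ((Φ₀.U b : (MatA 2)ˣ) : MatA 2).det = 1 :=
  B12RegularSpaces111SpecialUnitary.mem_suModel_Gc.1 (hS.1 b ⟨h1, h2⟩)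

/-- ★★ **THE `det` CLAUSE OF `TowerLoopSmall` AT A RECORD PAIR, WITH ITS (i)–(iv) DATA**: a pair of `recordUc … (X(c))` has a `det = 1` gauge transform `φ^u = embedPair Φ₀`, `Φ₀` satisfying
(i)–(iv) on the record frame of `X(c)`, and `det (φ^u).1 = 1` on every fine bond of the tower region of `c` — the first clause of `TowerLoopSmall k c a (φ^u).1`; the loop clause for `Φ₀` is the
complex small-field road of `JacKStep` ([I] p.263 L8–10). [cite: Balaban1987RG1, (1.10)–(1.16) p.262, p.263 L8–10] -/
theorem exists_gauge_towerDet_of_mem_recordUc {Mc k n : ℕ} (hMc : McGuard F Mc) (c : PBond (F.P (recordK₀ F Mc k + n)) (k + 1)) {α₀ α₁ : ℝ}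
    {φ : Sect2.CPair (F.P (recordK₀ F Mc k + n)) (MatA 2)}
    (hφ : encodeCfg F (recordK₀ F Mc k + n) φ ∈ recordUc F Mc k α₀ α₁ (recordK₀ F Mc k + n) (domOfBond F Mc k (recordK₀ F Mc k + n) c)) :
    ∃ (u : Site (F.P (recordK₀ F Mc k + n)) 0 → (MatA 2)ˣ) (Φ₀ : FieldPair (F.P (recordK₀ F Mc k + n)) 0 (MatA 2)ˣ (MatA 2)),
      (∀ x, ((u x : (MatA 2)ˣ) : MatA 2).det = 1) ∧
      B12RegularSpaces111.Satisfies (B12RegularSpaces111SpecialUnitary.suModel 2)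
        (Sect2.frameI (RzOfRecord F 2 (recordK₀ F Mc k + n)) Mc (k + 1) (Sect2.domSites (F.P (recordK₀ F Mc k + n)) Mc (k + 1) (domOfBond F Mc k (recordK₀ F Mc k + n) c)))
        (B12RegularSpaces111.StepConsts.ofParams (F.P (recordK₀ F Mc k + n)) (recordCB F) (k + 1)) α₀ α₁ α₀ Φ₀ ∧
      Sect2.cAct u φ = Sect2.embedPair Φ₀ ∧
      ∀ b : PBond (F.P (recordK₀ F Mc k + n)) 0,
        b ∈ bondsIn 0 (B14.Eq22Determines.blockIter (k + 1) ⁻¹' ({c.src, c.tgt} : Set (Site (F.P (recordK₀ F Mc k + n)) (k + 1)))) →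
          ((Sect2.cAct u φ).1 b).det = 1 := by
  obtain ⟨u, Φ₀, hu, hS, hact⟩ := exists_gauge_satisfies_of_mem_recordUc F _ hφ
  refine ⟨u, Φ₀, hu, hS, hact, fun b hb => ?_⟩
  obtain ⟨h1, h2⟩ := src_tgt_mem_domSites_of_mem_bondsIn_towerRegion F hMc (Nat.le_add_right _ _) c hb
  rw [hact]
  exact det_eq_one_of_satisfies F _ hS h1 h2

end Reading

end Summit.QuantumFields.YangMills.Theorems.BalabanUVNodesPortS1

end
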